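import Summits.QuantumFields.BalabanUV.T4Continuum.Support.NE3EnergyRateWSupOfEndpointChart
import Summits.QuantumFields.BalabanUV.T4Continuum.Support.NE3EnergyWeightedCovShape
import HarnessLib

/-!
# T⁴ programme, node NE3 — THE ENDPOINT-CHART END IS SLICE-GENERIC AND GAUGE-NORMALISATION-GENERIC: T-E_w♯ and the COVARIANT ROOT
# `NE3EnergyRateWCov` from an endpoint chart on ANY direction set `T` (skew, periodic members) carrying (P♮) and (RES♯), with the two
# covariant conjuncts read off the chart's start `Γ 0`

Cell `pub-balaban-gaps` (YM blitz, track G2, seat `ne3`, unit `pub-balaban-gaps-ne3`; writer prover-pub-balaban-gaps-ne3-g2-0, 2026-08-22),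
repair **R3** of `run/shared/lean/pub/pub-balaban-gaps/ne/NE3.md` §4 («type [B8] Thm 2 at the minimiser pair and re-run the route-Π junction on
it; caveat (c1) = slice match first»).  This module is the KERNEL HALF of caveat (c1): it certifies that the owner lineage's endpoint-chart
composition (`NE3EndpointChart.energyNormW_le_of_endpointChart`, p-accepted; `NE3EnergyRateWSupOfEndpointChart.ne3EnergyRateWSup_of_endpointChart`)
does NOT depend on WHICH slice carries the tangent datum, nor on HOW the gauge transformation `u` of the representation `U_A^u = W·e^{Γ 0}` is
normalised:

* the slice enters ONLY through three per-pair inputs on a direction set `T` — (P♮) `SlicePoincare L k W T CP (periodBox (N·L^k))`,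
  (RES♯) `CurlPairedResidual L k W T r (periodBox (N·L^k))`, and the chart's reference direction `Xref ∈ T` — plus the structural facts
  that the members of `T` are skew and `(N·L^k)`-periodic (the existing END fixes `T := frameFreeBlockLandauW L N k W`, the owner's `T_♮(W)`,
  and uses nothing else about it: `NE3EnergyRateWSupOfSlicePoincare.mem_frameFreeBlockLandauW_struct`);
* the gauge transformation `u` is ANY unitary `(N·L^k)`-periodic site field (`EndpointChart.gauge`): the comparison of actions is made at the
  two ENDS only (`EndpointChart.end_le`: `A(U_A^u) = A(U_A) ≤ A(W)`, gauge invariance + admissibility of `W`), so `u` need NOT be corner-trivial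
  and `U_A^u` need NOT lie in run A's fibre — in particular the `(1.29)`-RESTRICTED gauge transformation of [Balaban1985RegularSpaces] Thm 2
  («(R₀ū)ʲ(y) = 1, y ∈ Λ_j» instead of «u(y) = 1, y ∈ 𝔅_k», p. 80: «These conditions are very hard to work with analytically and we have to
  replace them by conditions imposed on some averages of u»; p. 81: «The set Σ_k is not contained in 𝔅_k(𝔅_k, V) because the gauge
  transformations u do not satisfy the necessary conditions (1.14)») is ADMISSIBLE as the chart's `u`.

CONTENT (all `theorem`s, [folklore] bookkeeping over landed theorems BY NAME; no `def`, 0 sorry):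
§1 `energyNormW_le_of_endpointChart_slice` — the weighted END at ONE pair on ANY `T` (skew, periodic members): endpoint chart in
   `energyNormW L k W · (periodBox (N·L^k))`, level data `(α, a)` with `(1 + 24√d(e^α−1)L^k)² + 48·d·a·(L^k)² ≤ Λ`, `112·d·a·CP·(L^k)² ≤ 1∕(2·card n)`,
   (P♮) on `T` with `CP ≥ 0`, `CP·(√Λ−1)² ≤ 1∕4`, (RES♯) on `T` with `r ≥ 0`, budget `2Λθ + Λθ² + κ + 2q ≤ cΛ∕2` ⟹
   `energyNormW L k W (Γ 0) (periodBox (N·L^k)) ≤ (1+θ₀)·(4r∕cΛ)` AND `‖Γ 0 (b)‖ ≤ ((√Λ−1)∕(24√d))·(L⁻¹)^k`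
   (`coer_of_slicePoincare_lambda` ∘ `energyNormW_le_of_endpointChart` ∘ `sup_le_of_lambdaW`, verbatim the owner's chain with `T` free);
§2 `ne3EnergyRateWSup_of_endpointChart_slice` — T-E_w♯ `NE3EnergyRateWSup d 𝒞 L N b g ((1+θ₀)·(4∕cΛ)·C′) ((√Λ−1)∕(24√d)) dom` from a per-pair
   endpoint chart on a per-pair direction set `T` (class-generic; EXACTLY `ne3EnergyRateWSup_of_endpointChart` with `frameFreeBlockLandauW L N k W`
   replaced by an existentially supplied `T` whose members are skew and periodic);
§3 `ne3EnergyRateWCov_of_endpointChart_slice` — the COVARIANT ROOT `NE3EnergyRateWCov d 𝒞 L N b g ((1+θ₀)·(4∕cΛ)·C′) Λ₁ Λ₂′ dom` from the same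
   per-pair data PLUS the two covariant conjuncts (Lip₁ᶜ) `≤ Λ₁·ξ²`, (Lip₂′ᶜ) `≤ Λ₂′·ξ³` (`ξ = (L⁻¹)^k`) ON THE CHART'S START `Γ 0` — the direction
   `Z` of the root IS `Γ 0` and its gauge IS the chart's `u`, so regular-gauge information about the representative passes to the root unchanged.

WHY (the use in R3).  [Balaban1985RegularSpaces] Thm 2 p. 83 at the pair `(U₀, U′U₀) := (W, U_A)` delivers a representative `U_A^u = W·e^{Z}` with
(1.36) `‖Z‖ ≤ B₁(α₀+α₁)·ξ`, first covariant differences `≤ B₁(α₀+α₁)·ξ²`, Hölder-β second differences `≤ B₂(β₀)(α₀+α₁)·ξ^{2+β}`, in the Landau gauge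
(1.38) relative to `W`, with `u` restricted by (1.29) — typed as the hypothesis SHAPE `Spine.NE3.PairLandauGaugeB8` (companion module).  By §3 the
junction «covariant root ⇐ B8-at-the-pair» reduces to supplying, per pair, an endpoint chart STARTING AT THAT `Z` on a direction set `T(W)` that
carries (P♮) and (RES♯) — the located remaining work of R3 (a chart supplier on [B8]'s surface and the printed coercivity TYPE
[Balaban1985PropagatorsII] Thm 3.3 (3.46) there), recorded in `ne/NE3.md` §4.

HONEST FRAMING.  Kernel bookkeeping; the endpoint chart, (P♮), (RES♯), the level data and the covariant conjuncts are HYPOTHESES (ours; the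
conjuncts' TYPE is [Balaban1985RegularSpaces] (1.36) pp. 82–83, context only — no printed sentence is a hypothesis of a theorem here); NOTHING
about Bałaban's minimisers is proved; T-E_w♯, the covariant root and **NE3 are NOT proved**; spine PROVED 0∕9; finite T⁴ rung (B)+1 — NOT
infinite volume, NOT mass gap, NOT `BetaPertH`, NOT Clay.  PLACEMENT: `Summits/QuantumFields/BalabanUV/T4Continuum/Support/` next to
`NE3EnergyRateWSupOfEndpointChart`; imports accepted modules only; moves nothing.  HONEST DEPENDENCY (cell page 1): continuum YM on T⁴ ⇐
BetaPertH ∧ nine spine estimates (0/9 proved); BetaPertH ⇐ (D1) ∧ (D4) ∧ CAP+tail; G-an2-4 gates asym, D1 and NE2/3/4.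
-/

set_option autoImplicit false

open scoped BigOperators Matrix.Norms.L2Operator
open NormedSpace Finset

namespace Summit.QuantumFields.BalabanUV.T4Continuum.NE3EnergyRateWCovOfEndpointChart

open Set
open Literature.MathematicalPhysics.QuantumFieldTheory.Balaban1983to89
open B7Prop1Explicit B7Prop2Explicit
open T4AveragingDeficitWall hiding Site Plane Plaq Bond
open T4AveragingDeficitWallBoundary (periodBox)
open AveragingDeficitPeriodicCounting (IsPeriodicDir)
open AveragingDeficitChartCalculus (cavg)
open MinimalActionSandwich (IsMinimiser)
open MinimalActionRate (Regular)
open NE3EnergyShapes (residualScale residualScale_nonneg IsUnitarySite IsPeriodicSite)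
open NE3HessForm (hess)
open NE3EnergyWeightedShapes (energyNormW energyNormW_nonneg CurlPairedResidual)
open NE3EnergyWeightedSupShape (NE3EnergyRateWSup)
open NE3EnergyWeightedCovShape (NE3EnergyRateWCov)
open NE3EnergyRateWSupOfSlicePoincare (cLambda cLambda_pos coer_of_slicePoincare_lambda)
open NE3EnergyRateWSupOfChart (sup_le_of_lambdaW)
open NE3SlicePoincareShape (SlicePoincare)
open NE3EndpointChart (EndpointChart energyNormW_le_of_endpointChart)

noncomputable section

variable {d : ℕ} {n : Type*} [Fintype n] [DecidableEq n]

/-! ## §1 The weighted END at one pair, on any direction set -/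

/-- **THE WEIGHTED END AT ONE PAIR ON ANY DIRECTION SET `T`** (`d ≥ 1`, `L, N ≥ 1`, unitary background `W = cavg L U_B`, `F = periodBox (N·L^k)`).
If the members of `T` are skew and `(N·L^k)`-periodic, `h` is an endpoint chart on `T` in the norm `energyNormW L k W · F` with constants
`(θ, κ, θ₀, q)` and plaquette radius `a ≥ 0`, the path has sup-radius `α ≥ 0` with `(1 + 24√d(e^α−1)L^k)² + 48·d·a·(L^k)² ≤ Λ` and
`112·d·a·CP·(L^k)² ≤ 1∕(2·card n)`, (P♮) `SlicePoincare L k W T CP F` (`CP ≥ 0`, `CP·(√Λ−1)² ≤ 1∕4`), (RES♯) `CurlPairedResidual L k W T r F` (`r ≥ 0`),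
`U_A` minimises run `k`, `θ₀ ≥ 0`, and `2Λθ + Λθ² + κ + 2q ≤ cΛ∕2` — THEN `energyNormW L k W (Γ 0) F ≤ (1+θ₀)·(4r∕cΛ)` and
`‖Γ 0 x μ‖ ≤ ((√Λ−1)∕(24√d))·(L⁻¹)^k`.  The owner's chain `coer_of_slicePoincare_lambda` ∘ `energyNormW_le_of_endpointChart` ∘ `sup_le_of_lambdaW`
with the direction set left free. [folklore] -/
theorem energyNormW_le_of_endpointChart_slice [Nonempty n] (hd : 1 ≤ d) {𝒞 : ℕ → Set (Site d → Fin d → (Matrix n n ℂ)ˣ)}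
    {L N k : ℕ} (hL : 1 ≤ L) (hN : 1 ≤ N) {V UA UB : Site d → Fin d → (Matrix n n ℂ)ˣ} (hW : IsUnitaryCfg (cavg L UB))
    {T : Set (Site d → Fin d → Matrix n n ℂ)} (hskewT : ∀ Y ∈ T, IsSkewDir Y)
    (hperT : ∀ Y ∈ T, IsPeriodicDir Y ((N * L ^ k : ℕ) : ℤ))
    {u : Site d → (Matrix n n ℂ)ˣ} {Γ Ψ Ψ' : ℝ → Site d → Fin d → Matrix n n ℂ} {Xref : Site d → Fin d → Matrix n n ℂ}
    {CP Λ θ κ θ₀ q a r α : ℝ} (hCP : 0 ≤ CP) (hreg₁ : CP * (Real.sqrt Λ - 1) ^ 2 ≤ 1 / 4) (hθ₀ : 0 ≤ θ₀) (hr : 0 ≤ r)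
    (hbudget : 2 * Λ * θ + Λ * θ ^ 2 + κ + 2 * q ≤ cLambda n CP Λ / 2) (hα : 0 ≤ α) (ha : 0 ≤ a)
    (hpath : EndpointChart 𝒞 L N k V UA UB u Γ Ψ Ψ' Xref T
      (fun Y => energyNormW L k (cavg L UB) Y (periodBox (N * L ^ k))) θ κ θ₀ q a)
    (hΓα : ∀ t (x : Site d) (μ : Fin d), ‖Γ t x μ‖ ≤ α)
    (hΛw : (1 + 24 * Real.sqrt d * (Real.exp α - 1) * (L : ℝ) ^ k) ^ 2 + 48 * d * a * ((L : ℝ) ^ k) ^ 2 ≤ Λ)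
    (hreg₂ : 112 * (d : ℝ) * a * CP * ((L : ℝ) ^ k) ^ 2 ≤ 1 / (2 * (Fintype.card n : ℝ)))
    (hP : SlicePoincare L k (cavg L UB) T CP (periodBox (N * L ^ k)))
    (hres : CurlPairedResidual L k (cavg L UB) T r (periodBox (N * L ^ k)))
    (hA : IsMinimiser d 𝒞 L N k V UA) :
    energyNormW L k (cavg L UB) (Γ 0) (periodBox (N * L ^ k)) ≤ (1 + θ₀) * (4 * r / cLambda n CP Λ) ∧
      ∀ (x : Site d) (μ : Fin d), ‖Γ 0 x μ‖ ≤ (Real.sqrt Λ - 1) / (24 * Real.sqrt d) * ((L : ℝ)⁻¹) ^ k := by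
  have hc := cLambda_pos (n := n) (Λ := Λ) hCP
  have hM : 1 ≤ N * L ^ k := Nat.mul_pos (by omega) (Nat.pow_pos (by omega))
  have hcoer := coer_of_slicePoincare_lambda hL k hM hW hskewT hperT hCP hP hpath.skew hα hΓα ha hpath.small hΛw hreg₁ hreg₂
  have hend := energyNormW_le_of_endpointChart hL hN hW hα ha hpath hcoer hΓα hΛw hres hA hθ₀ hr hc hbudget
  have hsup := sup_le_of_lambdaW hd hL k hα ha hΛw
  exact ⟨hend, fun x μ => (hΓα 0 x μ).trans hsup⟩

/-! ## §2 T-E_w♯ from per-pair endpoint charts on per-pair direction sets -/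

/-- **T-E_w♯ FROM ENDPOINT CHARTS ON ANY DIRECTION SETS** (class-generic; `d ≥ 1`, `L, N ≥ 1`).  EXACTLY
`NE3EnergyRateWSupOfEndpointChart.ne3EnergyRateWSup_of_endpointChart` with the fixed slice `frameFreeBlockLandauW L N k (cavg L U_B)` replaced, pair by
pair, by a supplied direction set `T` whose members are skew and `(N·L^k)`-periodic and which carries the chart's reference direction, (P♮) and
(RES♯) with `r = C′·residualScale d L N b g k`: THEN `NE3EnergyRateWSup d 𝒞 L N b g ((1+θ₀)·(4∕cΛ)·C′) ((√Λ−1)∕(24√d)) dom`. [folklore] -/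
theorem ne3EnergyRateWSup_of_endpointChart_slice [Nonempty n] (hd : 1 ≤ d) {𝒞 : ℕ → Set (Site d → Fin d → (Matrix n n ℂ)ˣ)}
    {L N : ℕ} (hL : 1 ≤ L) (hN : 1 ≤ N) {b g : ℝ} {dom : Set (Site d → Fin d → (Matrix n n ℂ)ˣ)} {CP Λ θ κ θ₀ q C' : ℝ}
    (hCP : 0 ≤ CP) (hreg₁ : CP * (Real.sqrt Λ - 1) ^ 2 ≤ 1 / 4) (hθ₀ : 0 ≤ θ₀) (hC' : 0 ≤ C')
    (hbudget : 2 * Λ * θ + Λ * θ ^ 2 + κ + 2 * q ≤ cLambda n CP Λ / 2)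
    (hchart : ∀ k : ℕ, 1 ≤ k → ∀ V ∈ dom, ∀ UA UB : Site d → Fin d → (Matrix n n ℂ)ˣ,
      IsMinimiser d 𝒞 L N k V UA → IsMinimiser d 𝒞 L N (k + 1) V UB → Regular d L N b g (k + 1) UB →
        IsUnitaryCfg (cavg L UB) ∧
        ∃ (T : Set (Site d → Fin d → Matrix n n ℂ)) (u : Site d → (Matrix n n ℂ)ˣ)
          (Γ Ψ Ψ' : ℝ → Site d → Fin d → Matrix n n ℂ) (Xref : Site d → Fin d → Matrix n n ℂ) (α a : ℝ),
          (∀ Y ∈ T, IsSkewDir Y) ∧ (∀ Y ∈ T, IsPeriodicDir Y ((N * L ^ k : ℕ) : ℤ)) ∧ 0 ≤ α ∧ 0 ≤ a ∧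
          EndpointChart 𝒞 L N k V UA UB u Γ Ψ Ψ' Xref T
            (fun Y => energyNormW L k (cavg L UB) Y (periodBox (N * L ^ k))) θ κ θ₀ q a ∧
          (∀ t (x : Site d) (μ : Fin d), ‖Γ t x μ‖ ≤ α) ∧
          (1 + 24 * Real.sqrt d * (Real.exp α - 1) * (L : ℝ) ^ k) ^ 2 + 48 * d * a * ((L : ℝ) ^ k) ^ 2 ≤ Λ ∧
          112 * (d : ℝ) * a * CP * ((L : ℝ) ^ k) ^ 2 ≤ 1 / (2 * (Fintype.card n : ℝ)) ∧
          SlicePoincare L k (cavg L UB) T CP (periodBox (N * L ^ k)) ∧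
          CurlPairedResidual L k (cavg L UB) T (C' * residualScale d L N b g k) (periodBox (N * L ^ k))) :
    NE3EnergyRateWSup d 𝒞 L N b g ((1 + θ₀) * (4 / cLambda n CP Λ) * C') ((Real.sqrt Λ - 1) / (24 * Real.sqrt d)) dom := by
  intro k hk V hV UA UB hA hB hreg
  obtain ⟨hW, T, u, Γ, Ψ, Ψ', Xref, α, a, hskewT, hperT, hα, ha, hpath, hΓα, hΛw, hreg₂, hP, hres⟩ :=
    hchart k hk V hV UA UB hA hB hreg
  have hr : 0 ≤ C' * residualScale d L N b g k := mul_nonneg hC' (residualScale_nonneg d L N b g k)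
  obtain ⟨hend, hsup⟩ := energyNormW_le_of_endpointChart_slice hd hL hN hW hskewT hperT hCP hreg₁ hθ₀ hr hbudget hα ha hpath
    hΓα hΛw hreg₂ hP hres hA
  refine ⟨u, Γ 0, hpath.gauge.1, hpath.gauge.2, hpath.skew 0, hpath.per 0, hpath.rep, ?_, hsup⟩
  have hcv : cavg L UB = rescale L (bavg L UB) := rfl
  rw [hcv] at hend
  refine hend.trans (le_of_eq ?_)
  ring

/-! ## §3 The covariant root from per-pair endpoint charts with regular-gauge data on the start -/

/-- **THE COVARIANT ROOT FROM ENDPOINT CHARTS ON ANY DIRECTION SETS, WITH THE TWO COVARIANT CONJUNCTS READ OFF THE START `Γ 0`**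
(class-generic; `d ≥ 1`, `L, N ≥ 1`).  Per pair: the data of §2 AND, for the start direction `Z := Γ 0` at the background `W := cavg L U_B`
(`= rescale L (bavg L U_B)`), (Lip₁ᶜ) `‖Ad (W (x+e κ) μ) (Z (x+e μ) κ) − Z x κ‖ ≤ Λ₁·((L⁻¹)^k)²` and (Lip₂′ᶜ)
`‖Ad (W (y+e κ) μ) (Ad (W (y+e κ+e μ) μ) (Z (y+2•e μ) κ) − Z (y+e μ) κ) − (Ad (W (y+e κ) μ) (Z (y+e μ) κ) − Z y κ)‖ ≤ Λ₂′·((L⁻¹)^k)³`.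
THEN `NE3EnergyWeightedCovShape.NE3EnergyRateWCov d 𝒞 L N b g ((1+θ₀)·(4∕cΛ)·C′) Λ₁ Λ₂′ dom` — with the SAME gauge `u` and direction `Z = Γ 0`
as the chart (so a representative in a regular gauge, e.g. [Balaban1985RegularSpaces] Thm 2's at the pair, passes its (1.36)-type bounds to the
root verbatim). [folklore] -/
theorem ne3EnergyRateWCov_of_endpointChart_slice [Nonempty n] (hd : 1 ≤ d) {𝒞 : ℕ → Set (Site d → Fin d → (Matrix n n ℂ)ˣ)}
    {L N : ℕ} (hL : 1 ≤ L) (hN : 1 ≤ N) {b g : ℝ} {dom : Set (Site d → Fin d → (Matrix n n ℂ)ˣ)}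
    {CP Λ θ κ θ₀ q C' Λ₁ Λ₂' : ℝ}
    (hCP : 0 ≤ CP) (hreg₁ : CP * (Real.sqrt Λ - 1) ^ 2 ≤ 1 / 4) (hθ₀ : 0 ≤ θ₀) (hC' : 0 ≤ C')
    (hbudget : 2 * Λ * θ + Λ * θ ^ 2 + κ + 2 * q ≤ cLambda n CP Λ / 2)
    (hchart : ∀ k : ℕ, 1 ≤ k → ∀ V ∈ dom, ∀ UA UB : Site d → Fin d → (Matrix n n ℂ)ˣ,
      IsMinimiser d 𝒞 L N k V UA → IsMinimiser d 𝒞 L N (k + 1) V UB → Regular d L N b g (k + 1) UB →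
        IsUnitaryCfg (cavg L UB) ∧
        ∃ (T : Set (Site d → Fin d → Matrix n n ℂ)) (u : Site d → (Matrix n n ℂ)ˣ)
          (Γ Ψ Ψ' : ℝ → Site d → Fin d → Matrix n n ℂ) (Xref : Site d → Fin d → Matrix n n ℂ) (α a : ℝ),
          (∀ Y ∈ T, IsSkewDir Y) ∧ (∀ Y ∈ T, IsPeriodicDir Y ((N * L ^ k : ℕ) : ℤ)) ∧ 0 ≤ α ∧ 0 ≤ a ∧
          EndpointChart 𝒞 L N k V UA UB u Γ Ψ Ψ' Xref T
            (fun Y => energyNormW L k (cavg L UB) Y (periodBox (N * L ^ k))) θ κ θ₀ q a ∧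
          (∀ t (x : Site d) (μ : Fin d), ‖Γ t x μ‖ ≤ α) ∧
          (1 + 24 * Real.sqrt d * (Real.exp α - 1) * (L : ℝ) ^ k) ^ 2 + 48 * d * a * ((L : ℝ) ^ k) ^ 2 ≤ Λ ∧
          112 * (d : ℝ) * a * CP * ((L : ℝ) ^ k) ^ 2 ≤ 1 / (2 * (Fintype.card n : ℝ)) ∧
          SlicePoincare L k (cavg L UB) T CP (periodBox (N * L ^ k)) ∧
          CurlPairedResidual L k (cavg L UB) T (C' * residualScale d L N b g k) (periodBox (N * L ^ k)) ∧
          (∀ (κ : Fin d) (x : Site d) (μ : Fin d),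
            ‖Ad (cavg L UB (x + e κ) μ) (Γ 0 (x + e μ) κ) - Γ 0 x κ‖ ≤ Λ₁ * (((L : ℝ)⁻¹) ^ k) ^ 2) ∧
          (∀ (κ μ : Fin d) (y : Site d),
            ‖Ad (cavg L UB (y + e κ) μ)
                (Ad (cavg L UB (y + e κ + e μ) μ) (Γ 0 (y + (2 : ℕ) • e μ) κ) - Γ 0 (y + e μ) κ)
              - (Ad (cavg L UB (y + e κ) μ) (Γ 0 (y + e μ) κ) - Γ 0 y κ)‖ ≤ Λ₂' * (((L : ℝ)⁻¹) ^ k) ^ 3)) :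
    NE3EnergyRateWCov d 𝒞 L N b g ((1 + θ₀) * (4 / cLambda n CP Λ) * C') Λ₁ Λ₂' dom := by
  intro k hk V hV UA UB hA hB hreg
  obtain ⟨hW, T, u, Γ, Ψ, Ψ', Xref, α, a, hskewT, hperT, hα, ha, hpath, hΓα, hΛw, hreg₂, hP, hres, h1, h2⟩ :=
    hchart k hk V hV UA UB hA hB hreg
  have hr : 0 ≤ C' * residualScale d L N b g k := mul_nonneg hC' (residualScale_nonneg d L N b g k)
  obtain ⟨hend, -⟩ := energyNormW_le_of_endpointChart_slice hd hL hN hW hskewT hperT hCP hreg₁ hθ₀ hr hbudget hα ha hpath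
    hΓα hΛw hreg₂ hP hres hA
  have hcv : cavg L UB = rescale L (bavg L UB) := rfl
  rw [hcv] at hend h1 h2
  refine ⟨u, Γ 0, hpath.gauge.1, hpath.gauge.2, hpath.skew 0, hpath.per 0, hpath.rep, ?_, h1, h2⟩
  refine hend.trans (le_of_eq ?_)
  ring

end

end Summit.QuantumFields.BalabanUV.T4Continuum.NE3EnergyRateWCovOfEndpointChart
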